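import Literature.NumberTheory.EllipticCurves.RamifiedLayerTwistedKummerProofs
import Literature.NumberTheory.EllipticCurves.LocalLayerValueGroupProofs
import Literature.NumberTheory.EllipticCurves.LocalFrobeniusGenerationProofs
import Literature.NumberTheory.EllipticCurves.UnramifiedLayerTwistedKummerProofs
import Literature.NumberTheory.GaloisRepresentations.HilbertNinetySubgroup
import HarnessLib

/-!
# The twisted Kummer count over the RAMIFIED layer `L_n = K̄_v^{N' ∩ H_{v,n}}` of a `ℤ_p`-tower

`Proofs` file (theorems only: **no definition, no named fact, nothing asserted**) in topic
`NumberTheory/EllipticCurves`; step (2) of the route to the layer Kummer count (C1ₙ) of Greenberg's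
Lemma 3.4 at the layers `n ≥ 1` (R. Greenberg, *Iwasawa theory for elliptic curves*, LNM 1716
(1999), §2 Prop. 2.2, p. 73; §3 Lemma 3.4, p. 89). Let `v ∣ p` be a place of the number field `K`
at which `p` is a uniformiser, `κ` a `ℤ_p`-extension of `K`, `H = H_{v,n} = (Γ_{K_v} → Γ_K)⁻¹(Gal(K̄/K_n))`
its `n`-th local layer group, `τ ∈ H` an arithmetic Frobenius (the layer is then totally ramified
at `v`), `π ∈ K̄_v` fixed by `H` with `|π|^d = |p|`, `pⁿ ∣ d` (for the cyclotomic tower over `ℚ`: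
`π_n = 2 - (ζ + ζ⁻¹)` resp. `N(1 - ζ_{p^{n+1}})`), `ζ_L` a primitive `(q^f - 1)`-th root of unity
(`q = #k_v`) and `L = K̄_v^{N' ∩ H}`, `N' = Gal(K̄_v/K_v(ζ_L))` — the unramified Teichmüller layer
over the completed `n`-th layer. This file instantiates the abstract ramified twisted Kummer count
`TwistedKummerRamified.exists_finset_forall_frobenius_zpow_rep` (p796006) for `L`:

* `exists_inertia_generator_cosets_localSubgroup` — **`Γ_{K_v}/H` is generated by an INERTIA
  element**: `ι₀ ∈ I`, `N ∣ pⁿ`, `ι₀^N ∈ H`, `Γ_{K_v} = ⋃ ι₀^a H` (the generator `σ₀` of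
  `ZpExtension.exists_generator_cosets_localSubgroup` is `τ^m ι₀ u` with `u ∈ H`,
  `exists_eq_frobenius_pow_mul_inertia_mul`; `τ ∈ H`).
* `exists_forall_smul_eq_and_spectralValuation_eq_pow_of_cosets` — the norm `∏_{j mod N} σ₀^j x`
  of an `S`-fixed `x` (`S ⊴ Γ`, `σ₀^N ∈ S`) is fixed by every `τ' = σ₀^a h`, `h ∈ S`, and has
  absolute value `|x|^N`.
* `exists_spectralValuation_eq_zpow_of_forall_mem_layer_smul_eq` — **the value group of `L` is
  `|π|^ℤ`** (`L/K̄_v^H` is unramified): the norm of `x ∈ L^×` along `ι₀` is INERTIA-fixed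
  (`I ≤ N'`), so `|x|^N ∈ |p|^ℤ = |π|^{dℤ}` (`exists_spectralValuation_eq_zpow_prime_of_forall_inertia`)
  and `N ∣ d`; `spectralValuation_le_of_forall_mem_layer_smul_eq`: `|x| < 1 ⇒ |x| ≤ |π|` on `L`.
* `exists_limit_of_finiteDimensional` — completeness of every finite subextension of `K̄_v/K_v` for
  the spectral valuation (`spectralNorm.completeSpace`), generalising `exists_limit_of_mem_adjoin`.
* `exists_layerField_mem_iff`, `finiteDimensional_layerField`, `toAbsGalHom_mem_of_layerField` —
  the intermediate field `L` with `y ∈ L ↔ (∀ σ ∈ H, σ ζ_L = ζ_L → σ y = y)` exists, is finite over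
  `K_v`, and `Aut_L(K̄_v) = N' ∩ H` (infinite Galois theory: `N' ∩ H` is open, hence closed,
  `InfiniteGalois.fixingSubgroup_fixedField`).
* `exists_finset_forall_frobenius_pow_rep_layerField` — **the twisted Kummer count over `L`**: a
  finite `R ⊆ L^×`, `#R ≤ N_e · q^{d + k d}`, `N_e = #{0 ≤ i < p^k : p^k ∣ (e - 1) i}`, such that
  every `α ∈ L^×` with `τ(α) α^{-e} ∈ (L^×)^{p^k}` is `r β^{p^k}`, `r ∈ R`, `β ∈ L^×` — hypothesis
  `hR` of `exists_finset_cocycle_reps_of_cyclotomicLine_subgroup`, with the exponent `d · k` of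
  Greenberg's corank `[(K_n)_v : ℚ_p]` (residues of `L` lie in `𝔽_{q^f}` because `τ^f ∈ N' ∩ H`).

HONEST FRAMING (cell `bsd-f1-sign2`, WIDTH-5 attach seat `bsd-line-att-p5` g42 on crux
stmt-BirchSwinnertonDyer-22298, lineage successor of g41): local field bookkeeping (Serre, *Local
Fields*, II §3, IV §4, XIV §4; Neukirch II (7.5), (9.11)); closes no item; BSD is not proved by any
of this.

## References

* [SerreLocalFields1979] J.-P. Serre, *Local Fields* (1979), II §3, IV §4 Prop. 16, XIV §4.
* [NeukirchANT1999] J. Neukirch, *Algebraic Number Theory* (1999), Ch. II (7.5), (9.11).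
* [GreenbergLNM1716] R. Greenberg, LNM 1716 (1999), §2 Prop. 2.2 (p. 73), §3 Lemma 3.4 (p. 89).

## Design

No definitions; the layer field is an arbitrary `L : IntermediateField K_v K̄_v` with the membership
hypothesis `hLmem : ∀ y, y ∈ L ↔ ∀ σ ∈ H, σ • ζ_L = ζ_L → σ • y = y` (existence:
`exists_layerField_mem_iff`); `noncomputable section`; one universe `u`. Axioms: `propext`,
`Classical.choice`, `Quot.sound`.
-/

noncomputable section

open scoped Classical NNReal
open NumberField IsDedekindDomain

universe u

namespace IsDedekindDomain.HeightOneSpectrum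

open Literature.NumberTheory.EllipticCurves Literature.NumberTheory.GaloisRepresentations Field
  Literature.NumberTheory.EllipticCurves.TwistedKummer
  Literature.NumberTheory.GaloisRepresentations.LocalWeilDatum

variable {K : Type u} [Field K] [NumberField K] {v : HeightOneSpectrum (𝓞 K)}
  {p : ℕ} [hp : Fact p.Prime]
  {w : Valuation (AlgebraicClosure (v.adicCompletion K)) ℝ≥0}
  (hw : ∀ x, (w x : ℝ) = spectralNorm (v.adicCompletion K) (AlgebraicClosure (v.adicCompletion K)) x)
  {𝔐 : Ideal v.localAbsIntegers} (h𝔐 : 𝔐 ∈ v.localPrimesAbove)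

/-! ## §1 An inertial generator of `Γ_{K_v}/H_{v,n}` -/

include h𝔐 in
/-- **`Γ_{K_v}/H_{v,n}` is generated by an inertia element when `H_{v,n}` contains a Frobenius.**
For a `ℤ_p`-extension `κ` of `K`, `n ≥ 0`, `H = H_{v,n}` and an arithmetic Frobenius `τ ∈ H` there
are `ι₀` in the inertia group and `N ∣ pⁿ`, `N ≥ 1`, with `ι₀^N ∈ H` and every `σ ∈ Γ_{K_v}` of the
form `ι₀^a h`, `h ∈ H`: the generator `σ₀` of `ZpExtension.exists_generator_cosets_localSubgroup`
is `τ^m ι₀ u` with `ι₀` inertial and `u ∈ H` (`exists_eq_frobenius_pow_mul_inertia_mul` for the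
open subgroup `H`), so `ι₀ ≡ σ₀` in the (abelian quotient by the) normal subgroup `H`. (The layer
`(K_n)_v/K_v` is totally ramified.) Neukirch, *ANT*, II (9.11); Greenberg, LNM 1716, §3 p. 87.
[cite: NeukirchANT1999, Ch. II Prop. (9.11)] -/
theorem exists_inertia_generator_cosets_localSubgroup (κ : ZpExtension K p) (n : ℕ)
    {τ : absoluteGaloisGroup (v.adicCompletion K)}
    (hτ : IsArithFrobAt (v.adicCompletionIntegers K) τ 𝔐)
    (hτH : τ ∈ localSubgroup (κ.layerSubgroup n) (v.adicCompletion K)) :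
    ∃ ι₀ ∈ 𝔐.inertia (absoluteGaloisGroup (v.adicCompletion K)), ∃ N : ℕ, 0 < N ∧ N ∣ p ^ n ∧
      ι₀ ^ N ∈ localSubgroup (κ.layerSubgroup n) (v.adicCompletion K) ∧
      ∀ σ : absoluteGaloisGroup (v.adicCompletion K), ∃ (a : ℕ) (h : absoluteGaloisGroup
        (v.adicCompletion K)), h ∈ localSubgroup (κ.layerSubgroup n) (v.adicCompletion K) ∧
          σ = ι₀ ^ a * h := by
  set H : Subgroup (absoluteGaloisGroup (v.adicCompletion K)) :=
    localSubgroup (κ.layerSubgroup n) (v.adicCompletion K) with hHdef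
  obtain ⟨σ₀, N, hN, hNdvd, hσN, hcos⟩ :=
    ZpExtension.exists_generator_cosets_localSubgroup κ (v.adicCompletion K) n
  have hHopen : IsOpen (H : Set (absoluteGaloisGroup (v.adicCompletion K))) :=
    isOpen_localSubgroup_layerSubgroup (v.adicCompletion K) κ n
  obtain ⟨m, ι₀, u, hι₀, hu, hσ₀⟩ := exists_eq_frobenius_pow_mul_inertia_mul v h𝔐 hτ hHopen σ₀
  -- `ι₀ ≡ σ₀` modulo the normal subgroup `H`
  have hmk : (QuotientGroup.mk ι₀ : absoluteGaloisGroup (v.adicCompletion K) ⧸ H) =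
      QuotientGroup.mk σ₀ := by
    have h1 : (QuotientGroup.mk (τ ^ m) : absoluteGaloisGroup (v.adicCompletion K) ⧸ H) = 1 :=
      (QuotientGroup.eq_one_iff _).mpr (H.pow_mem hτH m)
    have h2 : (QuotientGroup.mk u : absoluteGaloisGroup (v.adicCompletion K) ⧸ H) = 1 :=
      (QuotientGroup.eq_one_iff _).mpr hu
    rw [hσ₀, QuotientGroup.mk_mul, QuotientGroup.mk_mul, h1, h2, one_mul, mul_one]
  have hmkpow : ∀ a : ℕ, (QuotientGroup.mk (ι₀ ^ a) : absoluteGaloisGroup (v.adicCompletion K) ⧸ H) =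
      QuotientGroup.mk (σ₀ ^ a) := fun a ↦ by
    rw [QuotientGroup.mk_pow, QuotientGroup.mk_pow, hmk]
  refine ⟨ι₀, hι₀, N, hN, hNdvd, ?_, fun σ ↦ ?_⟩
  · have h := hmkpow N
    rw [(QuotientGroup.eq_one_iff (σ₀ ^ N)).mpr hσN, QuotientGroup.eq_one_iff] at h
    exact h
  · obtain ⟨a, h, -, hh, rfl⟩ := hcos σ
    refine ⟨a, (ι₀ ^ a)⁻¹ * (σ₀ ^ a * h), ?_, by group⟩
    have h1 : (ι₀ ^ a)⁻¹ * σ₀ ^ a ∈ H := QuotientGroup.eq.mp (hmkpow a)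
    have : (ι₀ ^ a)⁻¹ * (σ₀ ^ a * h) = (ι₀ ^ a)⁻¹ * σ₀ ^ a * h := by group
    rw [this]
    exact H.mul_mem h1 hh

/-! ## §2 The norm of an `S`-fixed element along `σ₀` -/

/-- Powers of `σ₀` act on an `S`-fixed element only through the exponent modulo `N`, when
`σ₀^N ∈ S`. [folklore] -/
private theorem pow_smul_eq_pow_mod_smul'' {S : Subgroup (absoluteGaloisGroup (v.adicCompletion K))}
    {σ₀ : absoluteGaloisGroup (v.adicCompletion K)} {N : ℕ} (hσN : σ₀ ^ N ∈ S)
    {x : AlgebraicClosure (v.adicCompletion K)} (hx : ∀ σ ∈ S, σ • x = x) (m : ℕ) :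
    σ₀ ^ m • x = σ₀ ^ (m % N) • x := by
  conv_lhs => rw [← Nat.mod_add_div m N, pow_add, pow_mul, mul_smul, hx _ (S.pow_mem hσN _)]

include hw in
/-- **The norm of an `S`-fixed element along `σ₀`.** Let `S ⊴ Γ_{K_v}`, `σ₀ ∈ Γ_{K_v}`, `N ≥ 1` with
`σ₀^N ∈ S` and `x ∈ K̄_v` fixed by `S`. Then `y = ∏_{j mod N} σ₀^j x` satisfies `|y| = |x|^N` and is
fixed by every `τ` of the form `σ₀^a h` with `h ∈ S` (the relative norm to the fixed field of
`⟨σ₀⟩ S`). [cite: NeukirchANT1999, Ch. II Prop. (9.11)] -/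
theorem exists_forall_smul_eq_and_spectralValuation_eq_pow_of_cosets
    (S : Subgroup (absoluteGaloisGroup (v.adicCompletion K))) [hS : S.Normal]
    {σ₀ : absoluteGaloisGroup (v.adicCompletion K)} {N : ℕ} (hN : 0 < N) (hσN : σ₀ ^ N ∈ S)
    {x : AlgebraicClosure (v.adicCompletion K)} (hx : ∀ σ ∈ S, σ • x = x) :
    ∃ y : AlgebraicClosure (v.adicCompletion K), w y = w x ^ N ∧
      ∀ τ : absoluteGaloisGroup (v.adicCompletion K),
        (∃ (a : ℕ) (h : absoluteGaloisGroup (v.adicCompletion K)), h ∈ S ∧ τ = σ₀ ^ a * h) →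
          τ • y = y := by
  haveI : NeZero N := ⟨hN.ne'⟩
  refine ⟨∏ j : ZMod N, σ₀ ^ (j.val) • x, ?_, fun τ hτ ↦ ?_⟩
  · rw [map_prod, Finset.prod_congr rfl fun j _ ↦ spectralValuation_smul hw (σ₀ ^ (j.val)) x,
      Finset.prod_const, Finset.card_univ, ZMod.card]
  · have hmove : ∀ (a j : ℕ) (h : absoluteGaloisGroup (v.adicCompletion K)), h ∈ S →
        (σ₀ ^ a * h) • (σ₀ ^ j • x) = σ₀ ^ ((a + j) % N) • x := by
      intro a j h hh
      have hconj : (σ₀ ^ j)⁻¹ * h * σ₀ ^ j ∈ S := by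
        have := hS.conj_mem h hh (σ₀ ^ j)⁻¹
        rwa [inv_inv] at this
      calc (σ₀ ^ a * h) • (σ₀ ^ j • x)
          = (σ₀ ^ a * σ₀ ^ j) • (((σ₀ ^ j)⁻¹ * h * σ₀ ^ j) • x) := by
            rw [← mul_smul, ← mul_smul]; congr 1; group
        _ = σ₀ ^ (a + j) • x := by rw [hx _ hconj, pow_add]
        _ = σ₀ ^ ((a + j) % N) • x := pow_smul_eq_pow_mod_smul'' hσN hx _
    obtain ⟨a, h, hh, rfl⟩ := hτ
    rw [Finset.smul_prod']
    calc ∏ j : ZMod N, (σ₀ ^ a * h) • (σ₀ ^ (j.val) • x)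
        = ∏ j : ZMod N, σ₀ ^ ((j + (a : ZMod N)).val) • x := by
          refine Finset.prod_congr rfl fun j _ ↦ ?_
          rw [hmove a j.val h hh, ZMod.val_add, ZMod.val_natCast, add_comm, Nat.add_mod_mod]
      _ = ∏ j : ZMod N, σ₀ ^ (j.val) • x :=
          Fintype.prod_equiv (Equiv.addRight (a : ZMod N)) _ _ fun _ ↦ rfl

/-! ## §3 The value group of the layer `L = K̄_v^{N' ∩ H}` is `|π|^ℤ` -/

section ValueGroup

variable (hpv : (p : 𝓞 K) ∈ v.asIdeal) (hϖ : Irreducible ((p : ℕ) : v.adicCompletionIntegers K))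
  (κ : ZpExtension K p) (n : ℕ)
  {τ : absoluteGaloisGroup (v.adicCompletion K)}
  (hτ : IsArithFrobAt (v.adicCompletionIntegers K) τ 𝔐)
  (hτH : τ ∈ localSubgroup (κ.layerSubgroup n) (v.adicCompletion K))
  {d : ℕ} (hdn : p ^ n ∣ d)
  {π : AlgebraicClosure (v.adicCompletion K)}
  (hπ : w π ^ d = w (p : AlgebraicClosure (v.adicCompletion K)))
  {f : ℕ} (hf : f ≠ 0) {ζL : AlgebraicClosure (v.adicCompletion K)}
  (hζL : IsPrimitiveRoot ζL (Nat.card (IsLocalRing.ResidueField (v.adicCompletionIntegers K)) ^ f - 1))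

include hw h𝔐 hpv hϖ hτ hτH hdn hπ hf hζL in
/-- **The values of the layer `L = K̄_v^{N' ∩ H_{v,n}}` lie in `|π|^ℤ`.** With the notation of the
module docstring, every `x ≠ 0` fixed by all `σ ∈ H` with `σ ζ_L = ζ_L` has `|x| = |π|^m` for some
`m ∈ ℤ`: take the inertial generator `ι₀` of `Γ_{K_v}/H` (§1); the norm `y = ∏_{j mod N} ι₀^j x` is
fixed by the whole inertia group (an inertial `ι = ι₀^a h` has `h ∈ H` inertial, and inertia fixes
`ζ_L`: `smul_eq_self_of_mem_inertia_of_pow_eq_one`), so `|x|^N = |y| = |p|^{m'}`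
(`exists_spectralValuation_eq_zpow_prime_of_forall_inertia`) `= |π|^{d m'}` with `N ∣ pⁿ ∣ d`, whence
`|x| = |π|^{(d/N) m'}`. This is "`L/(K_n)_v` is unramified: a uniformiser of `(K_n)_v` stays one in
`(K_n)_v(ζ_L)`" (Serre, *Local Fields*, IV §4; Neukirch II (7.5), (7.12)).
[cite: NeukirchANT1999, Ch. II Prop. (7.5)] [cite: SerreLocalFields1979, Ch. IV §4 Prop. 16] -/
theorem exists_spectralValuation_eq_zpow_of_forall_mem_layer_smul_eq
    {x : AlgebraicClosure (v.adicCompletion K)}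
    (hx : ∀ σ ∈ localSubgroup (κ.layerSubgroup n) (v.adicCompletion K), σ • ζL = ζL → σ • x = x)
    (hx0 : x ≠ 0) :
    ∃ m : ℤ, w x = w π ^ m := by
  set H : Subgroup (absoluteGaloisGroup (v.adicCompletion K)) :=
    localSubgroup (κ.layerSubgroup n) (v.adicCompletion K) with hHdef
  set I : Subgroup (absoluteGaloisGroup (v.adicCompletion K)) :=
    𝔐.inertia (absoluteGaloisGroup (v.adicCompletion K)) with hIdef
  set q : ℕ := Nat.card (IsLocalRing.ResidueField (v.adicCompletionIntegers K)) with hqdef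
  have hm0 : q ^ f - 1 ≠ 0 := residueCard_pow_sub_one_ne_zero (v := v) hf
  have hmw : w ((q ^ f - 1 : ℕ) : AlgebraicClosure (v.adicCompletion K)) = 1 :=
    spectralValuation_natCast_residueCard_pow_sub_one hw hf
  have hζLpow : ζL ^ (q ^ f - 1) = 1 := hζL.pow_eq_one
  have hIζ : ∀ ι ∈ I, ι • ζL = ζL := fun ι hι ↦
    smul_eq_self_of_mem_inertia_of_pow_eq_one hw h𝔐 hι hm0 hmw hζLpow
  -- the subgroup `S = N' ∩ H`, normal in `Γ_{K_v}`
  let S : Subgroup (absoluteGaloisGroup (v.adicCompletion K)) :=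
    { carrier := {σ | σ ∈ H ∧ σ • ζL = ζL}
      one_mem' := ⟨H.one_mem, one_smul _ ζL⟩
      mul_mem' := fun {σ σ'} hσ hσ' ↦ ⟨H.mul_mem hσ.1 hσ'.1, by rw [mul_smul, hσ'.2, hσ.2]⟩
      inv_mem' := fun {σ} hσ ↦ ⟨H.inv_mem hσ.1, by rw [inv_smul_eq_iff, hσ.2]⟩ }
  have hSmem : ∀ σ, σ ∈ S ↔ σ ∈ H ∧ σ • ζL = ζL := fun σ ↦ Iff.rfl
  have hsmul_prim : ∀ σ : absoluteGaloisGroup (v.adicCompletion K), IsPrimitiveRoot (σ • ζL) (q ^ f - 1) :=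
    fun σ ↦ by
      have hinj : Function.Injective (MulSemiringAction.toRingHom
          (absoluteGaloisGroup (v.adicCompletion K)) (AlgebraicClosure (v.adicCompletion K)) σ) :=
        RingHom.injective _
      exact hζL.map_of_injective hinj
  haveI : NeZero (q ^ f - 1) := ⟨hm0⟩
  haveI hSnormal : S.Normal := ⟨fun σ hσ g ↦ by
    rw [hSmem] at hσ ⊢
    refine ⟨(inferInstance : H.Normal).conj_mem σ hσ.1 g, ?_⟩
    obtain ⟨i, -, hi⟩ := hζL.eq_pow_of_pow_eq_one (hsmul_prim g⁻¹).pow_eq_one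
    rw [mul_smul, mul_smul, ← hi, smul_pow', hσ.2, hi, smul_inv_smul]⟩
  have hxS : ∀ σ ∈ S, σ • x = x := fun σ hσ ↦ hx σ hσ.1 hσ.2
  -- the inertial generator and the norm
  obtain ⟨ι₀, hι₀, N, hN, hNdvd, hι₀N, hcos⟩ :=
    exists_inertia_generator_cosets_localSubgroup h𝔐 κ n hτ hτH
  have hι₀NS : ι₀ ^ N ∈ S := ⟨hι₀N, hIζ _ (I.pow_mem hι₀ N)⟩
  obtain ⟨y, hyval, hy⟩ :=
    exists_forall_smul_eq_and_spectralValuation_eq_pow_of_cosets hw S hN hι₀NS hxS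
  -- `y` is fixed by the inertia group
  have hyI : ∀ ι ∈ I, ι • y = y := by
    intro ι hι
    obtain ⟨a, h, hh, hιeq⟩ := hcos ι
    refine hy ι ⟨a, h, ⟨hh, ?_⟩, hιeq⟩
    have hhI : h ∈ I := by
      have : h = (ι₀ ^ a)⁻¹ * ι := by rw [hιeq]; group
      rw [this]
      exact I.mul_mem (I.inv_mem (I.pow_mem hι₀ a)) hι
    exact hIζ h hhI
  have hx0' : w x ≠ 0 := (Valuation.ne_zero_iff w).mpr hx0
  have hy0 : y ≠ 0 := fun h ↦ by
    rw [h, map_zero] at hyval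
    exact pow_ne_zero N hx0' hyval.symm
  obtain ⟨m', hm'⟩ := exists_spectralValuation_eq_zpow_prime_of_forall_inertia hw h𝔐 hpv hϖ
    (𝔐 := 𝔐) hyI hy0
  -- `d = N c`
  obtain ⟨c, hc⟩ := hNdvd.trans hdn
  refine ⟨(c : ℤ) * m', ?_⟩
  have h1 : w x ^ N = ((w π ^ c) ^ m') ^ N := by
    rw [← hyval, hm', ← hπ, hc, mul_comm N c, pow_mul]
    rw [← zpow_natCast ((w π ^ c) ^ m') N, ← zpow_mul, mul_comm m' (N : ℤ), zpow_mul, zpow_natCast]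
  have h2 : w x = (w π ^ c) ^ m' := (pow_left_inj₀ zero_le zero_le hN.ne').mp h1
  rw [h2, zpow_mul, zpow_natCast]

include hw h𝔐 hpv hϖ hτ hτH hdn hπ hf hζL in
/-- **`π` is a uniformiser of the layer `L = K̄_v^{N' ∩ H_{v,n}}`**: for `x` fixed by all `σ ∈ H`
with `σ ζ_L = ζ_L`, `|x| < 1 ⇒ |x| ≤ |π|` (from `|x| ∈ |π|^ℤ`,
`exists_spectralValuation_eq_zpow_of_forall_mem_layer_smul_eq`). Hypothesis `hdisc` of
`TwistedKummerRamified.exists_finset_forall_frobenius_zpow_rep`. Serre, *Local Fields*, II §3.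
[cite: SerreLocalFields1979, Ch. II §3] -/
theorem spectralValuation_le_of_forall_mem_layer_smul_eq
    {x : AlgebraicClosure (v.adicCompletion K)}
    (hx : ∀ σ ∈ localSubgroup (κ.layerSubgroup n) (v.adicCompletion K), σ • ζL = ζL → σ • x = x)
    (hx1 : w x < 1) : w x ≤ w π := by
  by_cases hx0 : x = 0
  · rw [hx0, map_zero]; exact zero_le
  obtain ⟨hp1, hp0⟩ := spectralValuation_natCast_prime_lt_one_and_pos hw hpv
  -- `0 < |π| < 1`
  have hd0 : d ≠ 0 := by
    rintro rfl
    rw [pow_zero] at hπ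
    exact absurd hπ.symm (ne_of_lt hp1)
  have hπ0 : 0 < w π := pos_iff_ne_zero.mpr fun h ↦ by
    rw [h, zero_pow hd0] at hπ; exact absurd hπ (ne_of_lt hp0)
  have hπ1 : w π < 1 := by
    by_contra hle
    rw [not_lt] at hle
    have : 1 ≤ w π ^ d := one_le_pow₀ hle
    rw [hπ] at this
    exact absurd hp1 (not_lt.mpr this)
  obtain ⟨m, hm⟩ := exists_spectralValuation_eq_zpow_of_forall_mem_layer_smul_eq hw h𝔐 hpv hϖ κ n hτ
    hτH hdn hπ hf hζL hx hx0
  rw [hm] at hx1 ⊢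
  have hm1 : 1 ≤ m := by
    by_contra hlt
    rw [not_le] at hlt
    have : (1 : ℝ≥0) ≤ w π ^ m := one_le_zpow_of_nonpos₀ hπ0 hπ1.le (by omega)
    exact absurd hx1 (not_lt.mpr this)
  calc w π ^ m ≤ w π ^ (1 : ℤ) := zpow_le_zpow_right_of_le_one₀ hπ0 hπ1.le hm1
    _ = w π := zpow_one _

end ValueGroup

/-! ## §4 Completeness of the finite subextensions of `K̄_v/K_v` -/

include hw in
/-- **Completeness of a finite subextension `F` of `K̄_v/K_v`** for the spectral valuation: a
sequence `(x_r)` in `F` with `|x_{r+1} - x_r|_v ≤ ρ^{r+1}`, `ρ < 1`, converges to some `y ∈ F` with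
`|y - x_r|_v ≤ ρ^{r+1}` (`F` is finite-dimensional over the complete field `K_v`, hence complete for
the spectral norm, Mathlib `spectralNorm.completeSpace`; the bound by the ultrametric inequality).
The tree's `exists_limit_of_mem_adjoin` is the case `F = K_v(ζ)`. Neukirch, *ANT*, II (4.8) (a finite
extension of a complete valued field is complete); Serre, *Local Fields*, II §2 Prop. 3.
[cite: NeukirchANT1999, Ch. II Thm. (4.8)] -/
theorem exists_limit_of_finiteDimensional
    (F : IntermediateField (v.adicCompletion K) (AlgebraicClosure (v.adicCompletion K)))
    [FiniteDimensional (v.adicCompletion K) F] {ρ : ℝ≥0} (hρ1 : ρ < 1) (x : ℕ → F)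
    (hx : ∀ r, w ((x (r + 1) : AlgebraicClosure (v.adicCompletion K)) - x r) ≤ ρ ^ (r + 1)) :
    ∃ y : F, ∀ r, w ((y : AlgebraicClosure (v.adicCompletion K)) - x r) ≤ ρ ^ (r + 1) := by
  letI : NontriviallyNormedField (v.adicCompletion K) :=
    Valued.toNontriviallyNormedField (v.adicCompletion K) (WithZero (Multiplicative ℤ))
  letI : NormedField F := spectralNorm.normedField (v.adicCompletion K) F
  haveI : CompleteSpace F := spectralNorm.completeSpace (v.adicCompletion K) F
  -- the norm on `F` is the spectral valuation
  have hnorm : ∀ z : F, ‖z‖ = (w (z : AlgebraicClosure (v.adicCompletion K)) : ℝ) := fun z ↦ by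
    change spectralNorm (v.adicCompletion K) F z = _
    rw [hw, spectralNorm.eq_of_tower (L := AlgebraicClosure (v.adicCompletion K))]
    rfl
  -- the ultrametric estimate `|x_{r+k} - x_r| ≤ ρ^{r+1}`
  have hultra : ∀ r k, w ((x (r + k) : AlgebraicClosure (v.adicCompletion K)) - x r) ≤ ρ ^ (r + 1) := by
    intro r k
    induction k with
    | zero => rw [add_zero, sub_self, map_zero]; exact zero_le
    | succ k ih =>
      have e : (x (r + (k + 1)) : AlgebraicClosure (v.adicCompletion K)) - x r =
          ((x (r + k + 1) : AlgebraicClosure (v.adicCompletion K)) - x (r + k)) +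
            ((x (r + k) : AlgebraicClosure (v.adicCompletion K)) - x r) := by
        rw [← add_assoc]; ring
      rw [e]
      refine (Valuation.map_add w _ _).trans (max_le ((hx (r + k)).trans ?_) ih)
      exact pow_le_pow_right_of_le_one' hρ1.le (by omega)
  -- Cauchy, hence convergent
  have hcauchy : CauchySeq x := by
    refine cauchySeq_of_le_geometric (ρ : ℝ) (ρ : ℝ) (by exact_mod_cast hρ1) fun r ↦ ?_
    rw [dist_eq_norm, ← norm_neg, neg_sub, hnorm]
    push_cast
    rw [← pow_succ']
    exact_mod_cast hx r
  obtain ⟨y, hy⟩ := cauchySeq_tendsto_of_complete hcauchy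
  refine ⟨y, fun r ↦ ?_⟩
  -- pass to the limit in `|x_{r+k} - x_r| ≤ ρ^{r+1}`
  have hshift : Filter.Tendsto (fun k ↦ x (k + r)) Filter.atTop (nhds y) :=
    hy.comp (Filter.tendsto_add_atTop_nat r)
  have hlim : Filter.Tendsto (fun k ↦ ‖x (k + r) - x r‖) Filter.atTop (nhds ‖y - x r‖) :=
    (hshift.sub_const (x r)).norm
  have hle : ‖y - x r‖ ≤ (ρ : ℝ) ^ (r + 1) := by
    refine le_of_tendsto hlim (Filter.Eventually.of_forall fun k ↦ ?_)
    rw [hnorm, add_comm k r]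
    push_cast
    exact_mod_cast hultra r k
  rw [hnorm] at hle
  push_cast at hle
  exact_mod_cast hle

/-! ## §5 The layer field `L = K̄_v^{N' ∩ H}` -/

section LayerField

variable (H : Subgroup (absoluteGaloisGroup (v.adicCompletion K)))
  (ζL : AlgebraicClosure (v.adicCompletion K))

/-- **The layer field exists**: there is an intermediate field `L` of `K̄_v/K_v` whose elements are
exactly the `y` fixed by every `σ ∈ H` with `σ ζ_L = ζ_L` (the fixed field of the subgroup
`N' ∩ H`, `N' = {σ : σ ζ_L = ζ_L}`; Krull's Galois correspondence for `K̄_v/K_v`, Neukirch, *ANT*,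
IV (1.2)). [cite: NeukirchANT1999, Ch. IV Thm. (1.2)] -/
theorem exists_layerField_mem_iff :
    ∃ L : IntermediateField (v.adicCompletion K) (AlgebraicClosure (v.adicCompletion K)),
      ∀ y, y ∈ L ↔ ∀ σ ∈ H, σ • ζL = ζL → σ • y = y := by
  let S : Subgroup (absoluteGaloisGroup (v.adicCompletion K)) :=
    { carrier := {σ | σ ∈ H ∧ σ • ζL = ζL}
      one_mem' := ⟨H.one_mem, one_smul _ ζL⟩
      mul_mem' := fun {σ σ'} hσ hσ' ↦ ⟨H.mul_mem hσ.1 hσ'.1, by rw [mul_smul, hσ'.2, hσ.2]⟩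
      inv_mem' := fun {σ} hσ ↦ ⟨H.inv_mem hσ.1, by rw [inv_smul_eq_iff, hσ.2]⟩ }
  refine ⟨IntermediateField.fixedField
    (S.map (absoluteGaloisGroup.toAlgEquiv (v.adicCompletion K)).toMonoidHom), fun y ↦ ?_⟩
  rw [IntermediateField.mem_fixedField_iff]
  constructor
  · intro h σ hσH hσ
    exact h _ ⟨σ, ⟨hσH, hσ⟩, rfl⟩
  · rintro h g ⟨σ, ⟨hσH, hσ⟩, rfl⟩
    exact h σ hσH hσ

variable {H ζL}
  (hHopen : IsOpen (H : Set (absoluteGaloisGroup (v.adicCompletion K))))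
  {m : ℕ} (hm0 : m ≠ 0) (hζLm : ζL ^ m = 1)
  {L : IntermediateField (v.adicCompletion K) (AlgebraicClosure (v.adicCompletion K))}
  (hLmem : ∀ y, y ∈ L ↔ ∀ σ ∈ H, σ • ζL = ζL → σ • y = y)

include hHopen hm0 hζLm hLmem in
/-- **`Aut_L(K̄_v) = N' ∩ H`** for the layer field `L` of an OPEN subgroup `H`: its fixing subgroup is
exactly `{σ ∈ H : σ ζ_L = ζ_L}` — this subgroup is open (`H` is open and the stabiliser of `ζ_L`
contains the open fixing subgroup of the finite extension `K_v(ζ_L)`), hence closed, and `K̄_v/K_v`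
is Galois, so infinite Galois theory applies (Mathlib `InfiniteGalois.fixingSubgroup_fixedField`;
Krull's theorem, Neukirch, *ANT*, IV (1.2): closed subgroups ↔ intermediate fields).
[cite: NeukirchANT1999, Ch. IV Thm. (1.2)] -/
theorem fixingSubgroup_layerField_eq :
    ∀ g : AlgebraicClosure (v.adicCompletion K) ≃ₐ[v.adicCompletion K]
      AlgebraicClosure (v.adicCompletion K),
      g ∈ L.fixingSubgroup ↔
        (absoluteGaloisGroup.toAlgEquiv (v.adicCompletion K)).symm g ∈ H ∧
          (absoluteGaloisGroup.toAlgEquiv (v.adicCompletion K)).symm g • ζL = ζL := by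
  haveI := isGalois_algebraicClosure_adicCompletion (v := v)
  let e := absoluteGaloisGroup.toAlgEquiv (v.adicCompletion K)
  let S : Subgroup (absoluteGaloisGroup (v.adicCompletion K)) :=
    { carrier := {σ | σ ∈ H ∧ σ • ζL = ζL}
      one_mem' := ⟨H.one_mem, one_smul _ ζL⟩
      mul_mem' := fun {σ σ'} hσ hσ' ↦ ⟨H.mul_mem hσ.1 hσ'.1, by rw [mul_smul, hσ'.2, hσ.2]⟩
      inv_mem' := fun {σ} hσ ↦ ⟨H.inv_mem hσ.1, by rw [inv_smul_eq_iff, hσ.2]⟩ }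
  have hSmem : ∀ σ, σ ∈ S ↔ σ ∈ H ∧ σ • ζL = ζL := fun σ ↦ Iff.rfl
  -- `L` is the fixed field of `S`
  have hLeq : L = IntermediateField.fixedField (S.map e.toMonoidHom) := by
    apply le_antisymm
    · intro y hy
      rw [IntermediateField.mem_fixedField_iff]
      rintro g ⟨σ, ⟨hσH, hσ⟩, rfl⟩
      exact (hLmem y).mp hy σ hσH hσ
    · intro y hy
      rw [IntermediateField.mem_fixedField_iff] at hy
      exact (hLmem y).mpr fun σ hσH hσ ↦ hy _ ⟨σ, ⟨hσH, hσ⟩, rfl⟩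
  -- `S` is open: it contains the open subgroup `Fix(K_v(ζ_L)) ∩ H`
  have hN'open : IsOpen ((galFixing (v.adicCompletion K)
      (IntermediateField.adjoin (v.adicCompletion K) {ζL})) :
        Set (absoluteGaloisGroup (v.adicCompletion K))) := by
    haveI := finiteDimensional_adjoin_of_pow_eq_one (v := v) hm0 hζLm
    have h := (IntermediateField.adjoin (v.adicCompletion K) {ζL}).fixingSubgroup_isOpen
    have hcont : Continuous e := continuous_id
    exact h.preimage hcont
  have hSeq : (S : Set (absoluteGaloisGroup (v.adicCompletion K))) =
      (galFixing (v.adicCompletion K) (IntermediateField.adjoin (v.adicCompletion K) {ζL}) :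
        Set (absoluteGaloisGroup (v.adicCompletion K))) ∩ H := by
    ext σ
    rw [Set.mem_inter_iff, SetLike.mem_coe, SetLike.mem_coe, SetLike.mem_coe, hSmem,
      mem_galFixing_iff, forall_smul_eq_self_iff_smul_eq hm0 hζLm σ, and_comm]
  have hSopen : IsOpen (S : Set (absoluteGaloisGroup (v.adicCompletion K))) := by
    rw [hSeq]; exact hN'open.inter hHopen
  -- hence `S.map e` is closed
  have hSclosed : IsClosed ((S.map e.toMonoidHom :
      Subgroup (AlgebraicClosure (v.adicCompletion K) ≃ₐ[v.adicCompletion K]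
        AlgebraicClosure (v.adicCompletion K))) :
      Set (AlgebraicClosure (v.adicCompletion K) ≃ₐ[v.adicCompletion K]
        AlgebraicClosure (v.adicCompletion K))) := by
    refine Subgroup.isClosed_of_isOpen _ ?_
    have hHeq : ((S.map e.toMonoidHom : Subgroup (AlgebraicClosure (v.adicCompletion K)
        ≃ₐ[v.adicCompletion K] AlgebraicClosure (v.adicCompletion K))) :
        Set (AlgebraicClosure (v.adicCompletion K) ≃ₐ[v.adicCompletion K]
          AlgebraicClosure (v.adicCompletion K))) = e.symm ⁻¹' S := by
      rw [Subgroup.coe_map]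
      exact e.toEquiv.image_eq_preimage_symm _
    have hcont : Continuous e.symm := continuous_id
    rw [hHeq]
    exact hSopen.preimage hcont
  have hfix : L.fixingSubgroup = S.map e.toMonoidHom := by
    rw [hLeq]
    exact InfiniteGalois.fixingSubgroup_fixedField (k := v.adicCompletion K)
      (K := AlgebraicClosure (v.adicCompletion K)) ⟨_, hSclosed⟩
  intro g
  rw [hfix]
  constructor
  · rintro ⟨σ, hσ, rfl⟩
    rw [MulEquiv.coe_toMonoidHom, MulEquiv.symm_apply_apply]
    exact hσ
  · intro hg
    exact ⟨e.symm g, hg, by rw [MulEquiv.coe_toMonoidHom, MulEquiv.apply_symm_apply]⟩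

include hHopen hm0 hζLm hLmem in
/-- **The layer field of an open subgroup is finite over `K_v`**: its fixing subgroup `N' ∩ H` is
open (`fixingSubgroup_layerField_eq`), and an intermediate field of the Galois extension `K̄_v/K_v`
with open fixing subgroup is finite-dimensional (Mathlib `InfiniteGalois.isOpen_iff_finite`; Neukirch,
*ANT*, IV (1.2): open subgroups ↔ finite subextensions). [cite: NeukirchANT1999, Ch. IV Thm. (1.2)] -/
theorem finiteDimensional_layerField : FiniteDimensional (v.adicCompletion K) L := by
  haveI := isGalois_algebraicClosure_adicCompletion (v := v)
  let e := absoluteGaloisGroup.toAlgEquiv (v.adicCompletion K)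
  rw [← InfiniteGalois.isOpen_iff_finite]
  have hmem := fixingSubgroup_layerField_eq hHopen hm0 hζLm hLmem
  -- `Fix(L) = e.symm ⁻¹' (Fix(K_v(ζ_L)) ∩ H)`
  have hN'open : IsOpen ((galFixing (v.adicCompletion K)
      (IntermediateField.adjoin (v.adicCompletion K) {ζL})) :
        Set (absoluteGaloisGroup (v.adicCompletion K))) := by
    haveI := finiteDimensional_adjoin_of_pow_eq_one (v := v) hm0 hζLm
    have h := (IntermediateField.adjoin (v.adicCompletion K) {ζL}).fixingSubgroup_isOpen
    have hcont : Continuous e := continuous_id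
    exact h.preimage hcont
  have heq : (L.fixingSubgroup.carrier) = e.symm ⁻¹'
      ((galFixing (v.adicCompletion K) (IntermediateField.adjoin (v.adicCompletion K) {ζL}) :
        Set (absoluteGaloisGroup (v.adicCompletion K))) ∩ H) := by
    ext g
    change g ∈ L.fixingSubgroup ↔ _
    rw [hmem g, Set.mem_preimage, Set.mem_inter_iff, SetLike.mem_coe, SetLike.mem_coe,
      mem_galFixing_iff, forall_smul_eq_self_iff_smul_eq hm0 hζLm, and_comm]
  have hcont : Continuous e.symm := continuous_id
  rw [heq]
  exact (hN'open.inter hHopen).preimage hcont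

include hHopen hm0 hζLm hLmem in
/-- **`Aut_L(K̄_v) ⊆ N' ∩ H`**: every `L`-automorphism `τ'` of `K̄_v`, viewed in `Γ_{K_v}`
(`toAbsGalHom`), lies in `H` and fixes `ζ_L` — hypothesis `hL2` of
`exists_finset_cocycle_reps_of_cyclotomicLine_subgroup` (Krull's correspondence, Neukirch, *ANT*,
IV (1.2)). [cite: NeukirchANT1999, Ch. IV Thm. (1.2)] -/
theorem toAbsGalHom_mem_of_layerField
    (τ' : AlgebraicClosure (v.adicCompletion K) ≃ₐ[L] AlgebraicClosure (v.adicCompletion K)) :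
    toAbsGalHom L τ' ∈ H ∧ toAbsGalHom L τ' • ζL = ζL := by
  have hmem := fixingSubgroup_layerField_eq hHopen hm0 hζLm hLmem (τ'.restrictScalars (v.adicCompletion K))
  have hfix : τ'.restrictScalars (v.adicCompletion K) ∈ L.fixingSubgroup := by
    rw [IntermediateField.mem_fixingSubgroup_iff]
    intro y hy
    exact τ'.commutes ⟨y, hy⟩
  exact hmem.mp hfix

end LayerField

/-! ## §6 The twisted Kummer count over the layer field -/

section Count

variable (hpv : (p : 𝓞 K) ∈ v.asIdeal) (hϖ : Irreducible ((p : ℕ) : v.adicCompletionIntegers K))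
  (κ : ZpExtension K p) (n : ℕ)
  {τ : absoluteGaloisGroup (v.adicCompletion K)}
  (hτ : IsArithFrobAt (v.adicCompletionIntegers K) τ 𝔐)
  (hτH : τ ∈ localSubgroup (κ.layerSubgroup n) (v.adicCompletion K))
  {d : ℕ} (hdn : p ^ n ∣ d)
  {π : AlgebraicClosure (v.adicCompletion K)}
  (hπH : ∀ σ ∈ localSubgroup (κ.layerSubgroup n) (v.adicCompletion K), σ • π = π)
  (hπ : w π ^ d = w (p : AlgebraicClosure (v.adicCompletion K)))
  {f : ℕ} (hf : f ≠ 0) {ζL : AlgebraicClosure (v.adicCompletion K)}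
  (hζL : IsPrimitiveRoot ζL (Nat.card (IsLocalRing.ResidueField (v.adicCompletionIntegers K)) ^ f - 1))
  {L : IntermediateField (v.adicCompletion K) (AlgebraicClosure (v.adicCompletion K))}
  (hLmem : ∀ y, y ∈ L ↔
    ∀ σ ∈ localSubgroup (κ.layerSubgroup n) (v.adicCompletion K), σ • ζL = ζL → σ • y = y)

include hw h𝔐 hpv hϖ hτ hτH hdn hπH hπ hf hζL hLmem in
set_option maxHeartbeats 800000 in
/-- **The twisted Kummer count over the layer `L = K̄_v^{N' ∩ H_{v,n}}`.** With the notation of the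
module docstring (`v ∣ p` absolutely unramified, `τ ∈ H = H_{v,n}` an arithmetic Frobenius, `π`
fixed by `H` with `|π|^d = |p|`, `pⁿ ∣ d`, `ζ_L` a primitive `(q^f - 1)`-th root of unity, `L` the
layer field), for every `k` and every natural number `e` there is a finite set `R ⊆ L^×` with
`#R ≤ N_e · q^{d + k d}`, `N_e = #{0 ≤ i < p^k : p^k ∣ (e - 1) i}`, such that every `α ∈ L^×` with
`τ(α) α^{-e} ∈ (L^×)^{p^k}` is `r β^{p^k}` with `r ∈ R`, `β ∈ L^×` — the number of classes of
`H¹(L, μ_{p^k}) = L^×/(L^×)^{p^k}` fixed by the Frobenius twisted by `e`, with the exponent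
`d·k ≥ [(K_n)_v : ℚ_p]·k` of Greenberg's corank (LNM 1716, §2 Prop. 2.2, p. 73, where it comes
from Tate's Euler characteristic formula; here from the unit filtration of `L` with uniformiser `π`,
`TwistedKummerRamified.exists_finset_forall_frobenius_zpow_rep`, Serre XIV §4). The inputs: `π` is
a uniformiser of `L` (§3), `L` is complete (§4–§5), `τ L ⊆ L` (`τ⁻¹ σ τ ∈ N' ∩ H` for
`σ ∈ N' ∩ H`), the residues of `L` lie in `𝔽_{q^f}` (`τ^f ∈ N' ∩ H` fixes `L` and `τ` raises
residues to the `q`-th power). [cite: SerreLocalFields1979, Ch. XIV §4]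
[cite: GreenbergLNM1716, §2 Prop. 2.2 (proof, p. 73)] -/
theorem exists_finset_forall_frobenius_pow_rep_layerField (k : ℕ) (e : ℕ) :
    ∃ R : Finset (AlgebraicClosure (v.adicCompletion K)),
      R.card ≤ ((Finset.range (p ^ k)).filter fun i : ℕ ↦
          ((p ^ k : ℕ) : ℤ) ∣ ((e : ℤ) - 1) * i).card *
        Nat.card (IsLocalRing.ResidueField (v.adicCompletionIntegers K)) ^ (d + k * d) ∧
      (∀ r ∈ R, r ∈ L ∧ r ≠ 0) ∧
      ∀ α : AlgebraicClosure (v.adicCompletion K), α ∈ L → α ≠ 0 →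
        (∃ β ∈ L, β ≠ 0 ∧ τ • α * (α ^ e)⁻¹ = β ^ p ^ k) →
          ∃ r ∈ R, ∃ β ∈ L, β ≠ 0 ∧ α = r * β ^ p ^ k := by
  set H : Subgroup (absoluteGaloisGroup (v.adicCompletion K)) :=
    localSubgroup (κ.layerSubgroup n) (v.adicCompletion K) with hHdef
  -- the residue field `k_v`, `q = #k_v = p^f'`
  set kv := IsLocalRing.ResidueField (v.adicCompletionIntegers K) with hkv
  haveI : Finite kv := finite_residueField_adicCompletionIntegers K v
  letI : Fintype kv := Fintype.ofFinite _
  set q : ℕ := Nat.card kv with hqdef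
  have hq : 2 ≤ q := by rw [hqdef]; exact Finite.one_lt_card
  have hchar : ringChar kv = p := by
    have h0 : (p : kv) = 0 := by
      have h := (HeightOneSpectrum.residue_algebraMap_eq_zero_iff K v (p : 𝓞 K)).mpr hpv
      simpa only [map_natCast] using h
    exact CharP.ringChar_of_prime_eq_zero hp.out h0
  haveI hcharp : CharP kv p := ringChar.of_eq hchar
  obtain ⟨f', -, hcard⟩ := FiniteField.card kv p
  have hqf : q = p ^ (f' : ℕ) := by rw [hqdef, Nat.card_eq_fintype_card, hcard]
  have hpq : p ∣ q := by rw [hqf]; exact dvd_pow_self p (PNat.ne_zero f')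
  haveI : CharP (AlgebraicClosure kv) p :=
    charP_of_injective_algebraMap (algebraMap kv (AlgebraicClosure kv)).injective p
  have hpow_add : ∀ a b : AlgebraicClosure kv, (a + b) ^ q = a ^ q + b ^ q := fun a b ↦ by
    rw [hqf]; exact add_pow_char_pow a b p f'
  -- `|p|`, `|π|`
  obtain ⟨hp1, hp0⟩ := spectralValuation_natCast_prime_lt_one_and_pos hw hpv
  have hd0 : d ≠ 0 := by
    rintro rfl
    rw [pow_zero] at hπ
    exact absurd hπ.symm (ne_of_lt hp1)
  have hπ0 : 0 < w π := pos_iff_ne_zero.mpr fun h ↦ by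
    rw [h, zero_pow hd0] at hπ; exact absurd hπ (ne_of_lt hp0)
  have hπ1 : w π < 1 := by
    by_contra hle
    rw [not_lt] at hle
    have : 1 ≤ w π ^ d := one_le_pow₀ hle
    rw [hπ] at this
    exact absurd hp1 (not_lt.mpr this)
  -- the roots of unity
  have hm0 : q ^ f - 1 ≠ 0 := residueCard_pow_sub_one_ne_zero (v := v) hf
  have hmw : w ((q ^ f - 1 : ℕ) : AlgebraicClosure (v.adicCompletion K)) = 1 :=
    spectralValuation_natCast_residueCard_pow_sub_one hw hf
  have hζLpow : ζL ^ (q ^ f - 1) = 1 := hζL.pow_eq_one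
  have hτζ : τ • ζL = ζL ^ q := frobenius_smul_eq_pow_of_pow_eq_one hw h𝔐 hτ hm0 hmw hζLpow
  -- the layer as a subfield
  set Ls : Subfield (AlgebraicClosure (v.adicCompletion K)) := L.toSubfield with hLsdef
  have hLs : ∀ x, x ∈ Ls ↔ x ∈ L := fun x ↦ Iff.rfl
  have hHopen : IsOpen (H : Set (absoluteGaloisGroup (v.adicCompletion K))) :=
    isOpen_localSubgroup_layerSubgroup (v.adicCompletion K) κ n
  haveI : FiniteDimensional (v.adicCompletion K) L :=
    finiteDimensional_layerField hHopen hm0 hζLpow hLmem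
  -- `π ∈ L`, discreteness, completeness
  have hπL : π ∈ Ls := (hLmem π).mpr fun σ hσ _ ↦ hπH σ hσ
  have hdisc : ∀ x ∈ Ls, w x < 1 → w x ≤ w π := fun x hx hx1 ↦
    spectralValuation_le_of_forall_mem_layer_smul_eq hw h𝔐 hpv hϖ κ n hτ hτH hdn hπ hf hζL
      ((hLmem x).mp hx) hx1
  have hcomplete : ∀ (ρ : ℝ≥0), ρ < 1 → ∀ x : ℕ → AlgebraicClosure (v.adicCompletion K),
      (∀ r, x r ∈ Ls) →
      (∀ r, w (x (r + 1) - x r) ≤ ρ ^ (r + 1)) → ∃ y ∈ Ls, ∀ r, w (y - x r) ≤ ρ ^ (r + 1) := by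
    intro ρ hρ x hxL hx
    obtain ⟨y, hy⟩ := exists_limit_of_finiteDimensional hw L hρ (fun r ↦ ⟨x r, hxL r⟩) hx
    exact ⟨y, y.2, hy⟩
  -- the Frobenius as a ring endomorphism; `τ L ⊆ L`, `τ π = π`
  set Fh : AlgebraicClosure (v.adicCompletion K) →+* AlgebraicClosure (v.adicCompletion K) :=
    MulSemiringAction.toRingHom _ (AlgebraicClosure (v.adicCompletion K)) τ with hFhdef
  have hFh : ∀ x, Fh x = τ • x := fun x ↦ rfl
  have hFw : ∀ x, w (Fh x) = w x := fun x ↦ by rw [hFh]; exact spectralValuation_smul hw τ x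
  have hFL : ∀ x ∈ Ls, Fh x ∈ Ls := by
    intro x hx
    rw [hFh]
    refine (hLmem _).mpr fun σ hσH hσ ↦ ?_
    have hσ'H : τ⁻¹ * σ * τ ∈ H := H.mul_mem (H.mul_mem (H.inv_mem hτH) hσH) hτH
    have hσ' : (τ⁻¹ * σ * τ) • ζL = ζL := by
      rw [mul_smul, mul_smul, hτζ, smul_pow', hσ, ← hτζ, inv_smul_smul]
    rw [← mul_smul, show σ * τ = τ * (τ⁻¹ * σ * τ) by group, mul_smul,
      (hLmem x).mp hx _ hσ'H hσ']
  have hFπ : Fh π = π := by rw [hFh]; exact hπH τ hτH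
  -- the residue function
  obtain ⟨r, hr, -, hrF⟩ := exists_residueMap (v := v) hw h𝔐
  have hrF' : ∀ (z : w.integer) (h : w (τ • (z : AlgebraicClosure (v.adicCompletion K))) ≤ 1),
      r ⟨τ • (z : AlgebraicClosure (v.adicCompletion K)), h⟩ = r z ^ q :=
    fun z h ↦ hrF hτ z h
  let res : AlgebraicClosure (v.adicCompletion K) → AlgebraicClosure kv := fun x ↦
    if h : w x ≤ 1 then r ⟨x, h⟩ else 0
  have hres : ∀ x (h : w x ≤ 1), res x = r ⟨x, h⟩ := fun x h ↦ dif_pos h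
  have hres_add : ∀ x y, w x ≤ 1 → w y ≤ 1 → res (x + y) = res x + res y := fun x y hx hy ↦ by
    have hxy : w (x + y) ≤ 1 := (Valuation.map_add w x y).trans (max_le hx hy)
    rw [hres _ hxy, hres _ hx, hres _ hy, ← map_add]
    rfl
  have hres_mul : ∀ x y, w x ≤ 1 → w y ≤ 1 → res (x * y) = res x * res y := fun x y hx hy ↦ by
    have hxy : w (x * y) ≤ 1 := by rw [map_mul]; exact mul_le_one' hx hy
    rw [hres _ hxy, hres _ hx, hres _ hy, ← map_mul]
    rfl
  have hres_lt : ∀ x, w x ≤ 1 → (res x = 0 ↔ w x < 1) := fun x hx ↦ by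
    rw [hres _ hx]; exact hr ⟨x, hx⟩
  have hres_F : ∀ x, w x ≤ 1 → res (Fh x) = res x ^ q := fun x hx ↦ by
    have hFx : w (τ • x) ≤ 1 := by rw [spectralValuation_smul hw]; exact hx
    rw [hFh, hres _ hFx, hres _ hx]
    exact hrF' ⟨x, hx⟩ hFx
  -- the residues of `L` lie in `𝔽_{q^f}`: `τ^f ∈ N' ∩ H` fixes `L`
  have hτpowζ : ∀ j : ℕ, τ ^ j • ζL = ζL ^ q ^ j := fun j ↦ by
    induction j with
    | zero => rw [pow_zero, one_smul, pow_zero, pow_one]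
    | succ j ih => rw [pow_succ, mul_smul, hτζ, smul_pow', ih, ← pow_mul, ← pow_succ]
  have hτfζ : τ ^ f • ζL = ζL := by
    rw [hτpowζ]
    have h1 : q ^ f = (q ^ f - 1) + 1 := (Nat.sub_add_cancel (Nat.one_le_pow f q (by omega))).symm
    rw [h1, pow_succ, hζLpow, one_mul]
  have hres_pow : ∀ (j : ℕ) (x : AlgebraicClosure (v.adicCompletion K)), w x ≤ 1 →
      res (τ ^ j • x) = res x ^ q ^ j := fun j ↦ by
    induction j with
    | zero => intro x _; rw [pow_zero, one_smul, pow_zero, pow_one]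
    | succ j ih =>
      intro x hx
      have hjx : w (τ ^ j • x) ≤ 1 := by rw [spectralValuation_smul hw]; exact hx
      rw [pow_succ', mul_smul, ← hFh, hres_F _ hjx, ih x hx, ← pow_mul, ← pow_succ]
  have hres_L : ∀ x ∈ Ls, w x ≤ 1 → res x ^ q ^ f = res x := fun x hx hx1 ↦ by
    rw [← hres_pow f x hx1, (hLmem x).mp hx _ (H.pow_mem hτH f) hτfζ]
  -- the abstract count over the ramified layer
  obtain ⟨R, hRcard, hR, hRcov⟩ :=
    TwistedKummerRamified.exists_finset_forall_frobenius_zpow_rep w Ls p π hp0 hπL hπ1 hπ0 hdisc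
      Fh hFw hFL hFπ res q f hq hf hres_add hres_lt hres_F hres_L hpow_add k (e : ℤ) hcomplete
      hπ.symm hres_mul hpq hp.out
  refine ⟨R, hRcard, fun r' hr' ↦ ⟨(hLs r').mp (hR r' hr').1, (hR r' hr').2⟩, fun α hα hα0 hβ ↦ ?_⟩
  obtain ⟨β, hβL, hβ0, hβ⟩ := hβ
  obtain ⟨r', hr', β', hβ'L, hβ'0, h⟩ := hRcov α ((hLs α).mpr hα) hα0
    ⟨β, (hLs β).mpr hβL, hβ0, by rw [hFh, zpow_natCast]; exact hβ⟩
  exact ⟨r', hr', β', (hLs β').mp hβ'L, hβ'0, h⟩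

end Count

end IsDedekindDomain.HeightOneSpectrum
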